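/-
Copyright (c) 2026 the pub-hodgecm-mathlib formalisation cell (harness21).  Prover seat hodgecm-mathlib-K2Liu-p09 (g6): Track B «K2-LIT»,
hLiu418 = stmt-HodgeConjecture-24832; LEAD F0P6-plan RULING M-158d «A7-val road (σ)», instance layer I-4c (topology of the dictionary: `M_Δ` closed, `hcont`).
-/
import Summits.HodgeConjecture.HodgeConjecture.Theorems.K2LiuA7ValueInstanceDefs          -- ★ I-2 (`leviDeltaLoc`, `leviBlkD`, `partnerBlkDHom`, `rhoLoc`, `leviRhoLoc`)
import Summits.HodgeConjecture.HodgeConjecture.Theorems.K2LiuLocalSWBigCellCoordinate      -- ★ (K2Liu-p09 g5): `continuous_blkC_matA`, `continuous_blkD_matA` (brings `continuous_matA`, `continuous_blkB_matA`)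
import Literature.NumberTheory.GelbartRogawski1991.LocalLeraySectionSmooth                 -- ★ `QuadraticCoordinates.continuous_re ∕ _im` use pattern
import HarnessLib

/-!
# Crux `HLiu418`, road `K2_Liu`, organ A7-val, instance layer I-4c: TOPOLOGY OF THE DICTIONARY — `M_Δ` IS CLOSED; JOINT CONTINUITY `hcont`

Cell `hodgecm-mathlib`, crux item hLiu418 = `stmt-HodgeConjecture-24832`; squad K2 ∕ K2Liu; prover K2Liu-p09 (g6), organ lead A7-val.  THEOREMS ONLY; lane
`--supports stmt-HodgeConjecture-24832` (count-neutral helper).  Setting of ★ I-2.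
* §1 `isClosed_setOf_blkB_eq_zero_and_blkC_eq_zero`, `isClosedEmbedding_subtype_leviDeltaLoc` — the Siegel Levi `M_Δ = {B = C = 0}` is closed in `H_v` (so `↥M_Δ` is locally compact, σ-compact: the `Γ₁` instances of ★ V8e by `haveI`).
* §2 `continuous_reFrame`, `continuous_reFrame_symm`; `continuous_val_leviBlkD`, `continuous_val_partnerBlkDHom` (the two `D`-block letters are continuous).
* §3 **`continuous_leviRhoLoc_rhoLoc_apply`** — THE BINDER `hcont` of ★ V8e at the instance: `(a, g, x) ↦ aX a (ρ g x)` is jointly continuous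
  (`= R ((D(a ⊗ 1) · D(1 ⊗ g)) *ᵥ R⁻¹ x)`, ★ I-0 `leviAct_apply_reFrame`).
HONEST LABEL.  `HC_CM` is proved only modulo the 7 printed citations (2 remaining named inputs: hLiu418 = `stmt-HodgeConjecture-24832`,
h413 = `stmt-HodgeConjecture-24833`) until rung 0 closes.

## References
* [MoeglinVignerasWaldspurger1987] C. Mœglin, M.-F. Vignéras, J.-L. Waldspurger, LNM 1291, Chap. 2 II.6, II.8 (continuity of the Weil operators in the group variable).
* [Kudla1994] S. Kudla, Israel J. Math. 87 (1994), §3.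
-/

set_option autoImplicit false
set_option linter.dupNamespace false -- the mandated namespace repeats `HodgeConjecture.HodgeConjecture`

noncomputable section

open scoped Matrix Kronecker
open NumberField IsDedekindDomain Matrix Topology
open Literature.NumberTheory.Automorphic Literature.NumberTheory.Automorphic.UnitaryGroup
open Literature.NumberTheory.GelbartRogawski1991 Literature.NumberTheory.GelbartRogawski1991.GRConstruction
open Literature.NumberTheory.GelbartRogawski1991.UnitaryDualPair
open Literature.NumberTheory.GelbartRogawski1991.UnitaryDualPair.LocalSplitting
open Literature.NumberTheory.GelbartRogawski1991.AdaptedBlocks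
open Literature.NumberTheory.K2Lit.SiegelDoubled
open Literature.RepresentationTheory.HeisenbergGroup
open Summit.HodgeConjecture.HodgeConjecture.Cruxes.HLiu418.K2LiuLocalSWSectionDefs
open Summit.HodgeConjecture.HodgeConjecture.Cruxes.HLiu418.K2LiuLocalSWTensorAdaptedBlocks
open Summit.HodgeConjecture.HodgeConjecture.Cruxes.HLiu418.K2LiuDeltaModelRealFrame
open Summit.HodgeConjecture.HodgeConjecture.Cruxes.HLiu418.K2LiuA7ValuePartnerBlocks
open Summit.HodgeConjecture.HodgeConjecture.Cruxes.HLiu418.K2LiuA7ValueInstanceDefs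
open Summit.HodgeConjecture.HodgeConjecture.Cruxes.HLiu418.K2LiuLocalSWBigCellCoordinate
open Summit.HodgeConjecture.HodgeConjecture.Cruxes.HLiu418.K2LiuUnipDeltaRankOneHaar

namespace Summit.HodgeConjecture.HodgeConjecture.Cruxes.HLiu418.K2LiuA7ValueInstanceTopology

/-! ## §1 `M_Δ` is closed -/

section Closed

variable (L : Type) [Field L] [NumberField L] [IsCMField L]
variable {N M n : ℕ} (e : Fin N × Fin M ≃ Fin n)
  (dV : Fin N → L) (hdV : ∀ i, IsCMField.complexConj L (dV i) = dV i)
  (dW : Fin M → L) (hdW : ∀ i, IsCMField.complexConj L (dW i) = dW i)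
variable (v : HeightOneSpectrum (𝓞 (Fp L)))

/-- **the Siegel Levi `M_Δ = {h | B(h) = 0 ∧ C(h) = 0}` is closed in `H_v`** — stated on the carrier set written out (it is `↑(leviDeltaLoc …)` by `rfl`, ★ I-2
`mem_leviDeltaLoc_iff`); `B`, `C` are continuous (★ `continuous_blkB_matA`, ★ `continuous_blkC_matA`).  Hence `↥M_Δ` is locally compact and σ-compact (closed
subgroup of `H_v`): the `Γ₁` instances of ★ V8e by `haveI`. [cite: MoeglinVignerasWaldspurger1987, Chap. 2 II.8] -/
theorem isClosed_setOf_blkB_eq_zero_and_blkC_eq_zero :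
    IsClosed {h : UnitaryGroup.localPi L (IsCMField.complexConj L) (n + n) (hermD L e dV hdV dW hdW) v |
      blkB (matA (Fp L) L (IsCMField.complexConj L) v n h) = 0 ∧ blkC (matA (Fp L) L (IsCMField.complexConj L) v n h) = 0} :=
  (isClosed_eq (continuous_blkB_matA (Fp L) L (IsCMField.complexConj L) v n) continuous_const).inter
    (isClosed_eq (continuous_blkC_matA (Fp L) L (IsCMField.complexConj L) v n) continuous_const)

/-- `↥M_Δ` embeds closedly in `H_v`. [cite: MoeglinVignerasWaldspurger1987, Chap. 2 II.8] -/
theorem isClosedEmbedding_subtype_leviDeltaLoc :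
    Topology.IsClosedEmbedding (Subtype.val : ↥(leviDeltaLoc L e dV hdV dW hdW v) → UnitaryGroup.localPi L (IsCMField.complexConj L) (n + n) (hermD L e dV hdV dW hdW) v) :=
  (isClosed_setOf_blkB_eq_zero_and_blkC_eq_zero L e dV hdV dW hdW v).isClosedEmbedding_subtypeVal

end Closed

/-! ## §2 Continuity of the real frame and of the two `D`-block letters -/

section Letters

variable (L : Type) [Field L] [NumberField L] [IsCMField L] [Algebra.IsQuadraticExtension (Fp L) L]
  {δ : L} (hcδ : IsCMField.complexConj L δ = -δ) (hδ : δ ≠ 0)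
variable {N M n : ℕ} (e : Fin N × Fin M ≃ Fin n)
  (dV : Fin N → L) (hdV : ∀ i, IsCMField.complexConj L (dV i) = dV i)
  (dW : Fin M → L) (hdW : ∀ i, IsCMField.complexConj L (dW i) = dW i)
variable {M₂ M' n' : ℕ} (eW : Fin M × Fin M₂ ≃ Fin M') (e' : Fin N × Fin M' ≃ Fin n')
  (dV' : Fin M₂ → L) (hdV' : ∀ k, IsCMField.complexConj L (dV' k) = dV' k)
variable (v : HeightOneSpectrum (𝓞 (Fp L)))

/-- the real frame `R : (L ⊗ L⁺_v)^{k} → L⁺_v^{k+k}` is continuous (`re`, `im` are, ★ `QuadraticCoordinates.continuous_re ∕ _im`). [folklore] -/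
theorem continuous_reFrame (k : ℕ) : Continuous (reFrame (Fp L) L (IsCMField.complexConj L) hcδ hδ v k) := by
  have hΨ : Continuous (quadraticLocalEquiv L v (IsCMField.complexConj L) hcδ hδ).toLinearEquiv.toAddEquiv.symm :=
    (quadraticLocalEquiv L v (IsCMField.complexConj L) hcδ hδ).symm.continuous
  have hre := QuadraticCoordinates.continuous_re _ hΨ
  have him := QuadraticCoordinates.continuous_im _ hΨ
  refine continuous_pi fun j => ?_
  obtain ⟨i, rfl⟩ := (e₂ k).surjective j
  rcases i with i | i
  · simp only [reFrame_apply, glue_apply_inl]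
    exact hre.comp (continuous_apply i)
  · simp only [reFrame_apply, glue_apply_inr]
    exact him.comp (continuous_apply i)

/-- the inverse real frame is continuous (it is `L⁺_v`-linear on `L⁺_v^{k+k}`). [folklore] -/
theorem continuous_reFrame_symm (k : ℕ) : Continuous (reFrame (Fp L) L (IsCMField.complexConj L) hcδ hδ v k).symm := by
  refine continuous_pi fun i => ?_
  simp only [reFrame_symm_apply]
  exact (quadraticLocalEquiv L v (IsCMField.complexConj L) hcδ hδ).continuous.comp
    (((continuous_apply _).comp continuous_id).prodMk ((continuous_apply _).comp continuous_id))

omit [Algebra.IsQuadraticExtension (Fp L) L] in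
/-- `m ↦ D(m ⊗ 1) = reindex epsV (D(m) ⊗ₖ 1)` is continuous on `M_Δ` (★ `continuous_blkD_matA`, ★ I-2 `val_leviBlkD`). [cite: MoeglinVignerasWaldspurger1987, Chap. 2 II.8] -/
theorem continuous_val_leviBlkD :
    Continuous fun m : ↥(leviDeltaLoc L e dV hdV dW hdW v) => (leviBlkD L e dV hdV dW hdW eW e' dV' hdV' v m).val := by
  have h : (fun m : ↥(leviDeltaLoc L e dV hdV dW hdW v) => (leviBlkD L e dV hdV dW hdW eW e' dV' hdV' v m).val) =
      fun m : ↥(leviDeltaLoc L e dV hdV dW hdW v) => Matrix.reindex (epsV e eW e') (epsV e eW e')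
        (blkD (matA (Fp L) L (IsCMField.complexConj L) v n (m : UnitaryGroup.localPi L (IsCMField.complexConj L) (n + n) (hermD L e dV hdV dW hdW) v)) ⊗ₖ
          (1 : Matrix (Fin M₂) (Fin M₂) (LocalRing L v))) :=
    funext fun m => val_leviBlkD L e dV hdV dW hdW eW e' dV' hdV' v m
  rw [h]
  have hD := (continuous_blkD_matA (Fp L) L (IsCMField.complexConj L) v n (JD := hermD L e dV hdV dW hdW)).comp
    (continuous_subtype_val (p := fun h => h ∈ leviDeltaLoc L e dV hdV dW hdW v))
  refine continuous_matrix fun i j => ?_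
  simp only [Matrix.reindex_apply, Matrix.submatrix_apply, Matrix.kroneckerMap_apply]
  exact (hD.matrix_elem _ _).mul continuous_const

omit [Algebra.IsQuadraticExtension (Fp L) L] in
/-- `g ↦ D(1 ⊗ g) = reindex epsV (1 ⊗ₖ G)` is continuous on `U(V′_v)` (★ I-2 `val_partnerBlkDHom`; `g ↦ G` is the continuous ★ `localGLPiEquiv`). [cite: MoeglinVignerasWaldspurger1987, Chap. 2 II.8] -/
theorem continuous_val_partnerBlkDHom :
    Continuous fun g : UnitaryGroup.localPi L (IsCMField.complexConj L) M₂ (Matrix.diagonal dV') v => (partnerBlkDHom L e dV hdV dW hdW eW e' dV' hdV' v g).val := by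
  have h : (fun g : UnitaryGroup.localPi L (IsCMField.complexConj L) M₂ (Matrix.diagonal dV') v => (partnerBlkDHom L e dV hdV dW hdW eW e' dV' hdV' v g).val) =
      fun g : UnitaryGroup.localPi L (IsCMField.complexConj L) M₂ (Matrix.diagonal dV') v => Matrix.reindex (epsV e eW e') (epsV e eW e')
        ((1 : Matrix (Fin n) (Fin n) (LocalRing L v)) ⊗ₖ ((UnitaryGroup.localGLPiEquiv L M₂ v).symm (g : UnitaryGroup.LocalGLPi L M₂ v)).val) :=
    funext fun g => val_partnerBlkDHom L e dV hdV dW hdW eW e' dV' hdV' v g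
  rw [h]
  have hG : Continuous fun g : UnitaryGroup.localPi L (IsCMField.complexConj L) M₂ (Matrix.diagonal dV') v =>
      ((UnitaryGroup.localGLPiEquiv L M₂ v).symm (g : UnitaryGroup.LocalGLPi L M₂ v)).val :=
    Units.continuous_val.comp ((UnitaryGroup.localGLPiEquiv L M₂ v).symm.continuous.comp continuous_subtype_val)
  refine continuous_matrix fun i j => ?_
  simp only [Matrix.reindex_apply, Matrix.submatrix_apply, Matrix.kroneckerMap_apply]
  exact continuous_const.mul (hG.matrix_elem _ _)

/-! ## §3 `hcont`: joint continuity of `(a, g, x) ↦ aX a (ρ g x)` -/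

/-- the formula: `aX a (ρ g x) = R ((D(a ⊗ 1) · D(1 ⊗ g)) *ᵥ R⁻¹ x)` (★ I-0 `leviAct_apply_reFrame`). [cite: Kudla1994, §3] -/
theorem leviRhoLoc_rhoLoc_apply (a : ↥(leviDeltaLoc L e dV hdV dW hdW v)) (g : UnitaryGroup.localPi L (IsCMField.complexConj L) M₂ (Matrix.diagonal dV') v)
    (x : Fin (n' + n') → v.adicCompletion (Fp L)) :
    leviRhoLoc L hcδ hδ e dV hdV dW hdW eW e' dV' hdV' v a (rhoLoc L hcδ hδ e dV hdV dW hdW eW e' dV' hdV' v g x) =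
      reFrame (Fp L) L (IsCMField.complexConj L) hcδ hδ v n'
        (((leviBlkD L e dV hdV dW hdW eW e' dV' hdV' v a).val * (partnerBlkDHom L e dV hdV dW hdW eW e' dV' hdV' v g).val) *ᵥ
          (reFrame (Fp L) L (IsCMField.complexConj L) hcδ hδ v n').symm x) := by
  conv_lhs => rw [← (reFrame (Fp L) L (IsCMField.complexConj L) hcδ hδ v n').apply_symm_apply x]
  rw [rhoLoc_apply, leviRhoLoc_apply, leviBlkDHom_apply, leviAct_apply_reFrame, leviAct_apply_reFrame, Matrix.mulVec_mulVec]

/-- **`hcont` AT THE INSTANCE: `(a, g, x) ↦ aX a (ρ g x)` is jointly continuous** on `M_Δ × U(V′_v) × X_Δ` (the formula above; `R`, `R⁻¹`, the two `D`-block letters and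
`(A, b) ↦ A *ᵥ b` are continuous). [cite: MoeglinVignerasWaldspurger1987, Chap. 2 II.8] -/
theorem continuous_leviRhoLoc_rhoLoc_apply :
    Continuous fun p : (↥(leviDeltaLoc L e dV hdV dW hdW v) × UnitaryGroup.localPi L (IsCMField.complexConj L) M₂ (Matrix.diagonal dV') v) ×
        (Fin (n' + n') → v.adicCompletion (Fp L)) =>
      leviRhoLoc L hcδ hδ e dV hdV dW hdW eW e' dV' hdV' v p.1.1 (rhoLoc L hcδ hδ e dV hdV dW hdW eW e' dV' hdV' v p.1.2 p.2) := by
  have h : (fun p : (↥(leviDeltaLoc L e dV hdV dW hdW v) × UnitaryGroup.localPi L (IsCMField.complexConj L) M₂ (Matrix.diagonal dV') v) ×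
        (Fin (n' + n') → v.adicCompletion (Fp L)) =>
      leviRhoLoc L hcδ hδ e dV hdV dW hdW eW e' dV' hdV' v p.1.1 (rhoLoc L hcδ hδ e dV hdV dW hdW eW e' dV' hdV' v p.1.2 p.2)) =
      fun p => reFrame (Fp L) L (IsCMField.complexConj L) hcδ hδ v n'
        (((leviBlkD L e dV hdV dW hdW eW e' dV' hdV' v p.1.1).val * (partnerBlkDHom L e dV hdV dW hdW eW e' dV' hdV' v p.1.2).val) *ᵥ
          (reFrame (Fp L) L (IsCMField.complexConj L) hcδ hδ v n').symm p.2) :=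
    funext fun p => leviRhoLoc_rhoLoc_apply L hcδ hδ e dV hdV dW hdW eW e' dV' hdV' v p.1.1 p.1.2 p.2
  rw [h]
  refine (continuous_reFrame L hcδ hδ v n').comp (Continuous.matrix_mulVec ?_ ((continuous_reFrame_symm L hcδ hδ v n').comp continuous_snd))
  exact (((continuous_val_leviBlkD L e dV hdV dW hdW eW e' dV' hdV' v).comp (continuous_fst.comp continuous_fst)).matrix_mul
    ((continuous_val_partnerBlkDHom L e dV hdV dW hdW eW e' dV' hdV' v).comp (continuous_snd.comp continuous_fst)))

end Letters

end Summit.HodgeConjecture.HodgeConjecture.Cruxes.HLiu418.K2LiuA7ValueInstanceTopology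

end
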